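import Summits.Ventures.Crystal3D.Theses.StickyWulffConstant
import Literature.Analysis.PDE.EvansKrylovPowerMean

/-!
# Route StickyWulffConstant — the split glue `LiminfAssemblySplit` (stmt-Ventures-19484), PROVED:
`GenericWallFloor → CoaxialWallLaw → PolycrystalWulffBound → TextureLiminf → LiminfAssembly`

HONEST FRAMING. Part of the venture `Summits/Ventures/Crystal3D` (cell `crystal3d-full`; split v4 of
the crux `LiminfAssembly` by planner p1 gen 8, ROUTE §57; this file is the planner's sorry-free
turnkey proof `HOME/cf-p1/route/bc/v4/LiminfAssemblySplitHolds.lean`, landed by the crux seat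
`crystal3d-wulff-p1`). GLUE ONLY — elementary real analysis, no crux is touched: by contradiction, a
sequence of unit packings with deficiency `< (κ - ε) N^{2/3}`, `κ = 6·2^{1/3}`, is fed to
`TextureLiminf` (with `K = κ`, `δ = min (ε/(4κ)) (1/2)`, `θ = ε/4`); the finitely many limiting
textures each have continuum energy `≥ κ (√2 |E_i|)^{2/3}` by `PolycrystalWulffBound`; subadditivity
of `t ↦ t^{2/3}` (`Literature.Analysis.PDE.EvansKrylov.rpow_sum_le_sum_rpow`) and total mass
`√2 Σ|E_i| ≥ 1 - δ` give `Σ energy ≥ κ (1 - δ) ≥ κ - ε/4`, contradicting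
`Σ energy - ε/4 ≤ deficiency / N^{2/3} < κ - ε` along the subsequence.
WHAT THIS IS NOT: none of the four children (`GenericWallFloor`, `CoaxialWallLaw`,
`PolycrystalWulffBound`, `TextureLiminf`) nor `NoReconstructionGain` / `StackingLiminf` is proved
here; rung F-C1 is not moved by this glue alone.
-/

noncomputable section

namespace Summit.Ventures.Crystal3D.Theorems

open Summit.Ventures.Crystal3D Filter
open Summit.Ventures.Crystal3D.Theses.StickyWulffConstant
open scoped BigOperators

/-- Arithmetic core of the glue: per-profile continuum bounds `κ (√2 V_i)^{2/3} ≤ E_i`, total mass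
`√2 Σ V_i ≥ 1 - δ` (`0 ≤ δ ≤ 1/2`) and `V_i ≥ 0` give `κ (1 - δ) ≤ Σ E_i` (uses `1 - δ ≤ (1 - δ)^{2/3}`
and the subadditivity of `t ↦ t^{2/3}`). -/
theorem kappa_mul_one_sub_le_sum_energy {p : ℕ} (κ δ : ℝ) (hκ : 0 ≤ κ) (hδ0 : 0 ≤ δ)
    (hδ1 : δ ≤ 1 / 2) (En V : Fin p → ℝ)
    (hPV : ∀ i, κ * (Real.sqrt 2 * V i) ^ ((2 : ℝ) / 3) ≤ En i)
    (hmass : 1 - δ ≤ Real.sqrt 2 * ∑ i, V i) (hV : ∀ i, 0 ≤ V i) :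
    κ * (1 - δ) ≤ ∑ i, En i := by
  have hμnn : ∀ i, 0 ≤ Real.sqrt 2 * V i := fun i => mul_nonneg (Real.sqrt_nonneg _) (hV i)
  have h1 : κ * ∑ i, (Real.sqrt 2 * V i) ^ ((2 : ℝ) / 3) ≤ ∑ i, En i := by
    rw [Finset.mul_sum]; exact Finset.sum_le_sum fun i _ => hPV i
  have h2 : (∑ i, Real.sqrt 2 * V i) ^ ((2 : ℝ) / 3) ≤ ∑ i, (Real.sqrt 2 * V i) ^ ((2 : ℝ) / 3) :=
    Literature.Analysis.PDE.EvansKrylov.rpow_sum_le_sum_rpow (by norm_num) (by norm_num) _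
      (fun i _ => hμnn i)
  have hmass' : 1 - δ ≤ ∑ i, Real.sqrt 2 * V i := by rwa [← Finset.mul_sum]
  have h3 : (1 - δ) ^ ((2 : ℝ) / 3) ≤ (∑ i, Real.sqrt 2 * V i) ^ ((2 : ℝ) / 3) :=
    Real.rpow_le_rpow (by linarith) hmass' (by norm_num)
  have h4 : 1 - δ ≤ (1 - δ) ^ ((2 : ℝ) / 3) :=
    Real.self_le_rpow_of_le_one (by linarith) (by linarith) (by norm_num)
  exact (mul_le_mul_of_nonneg_left (h4.trans (h3.trans h2)) hκ).trans h1

/-- **The split glue of `LiminfAssembly` holds** (item stmt-Ventures-19484 of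
route `route-Ventures-StickyWulffConstant`): the two wall laws, the polycrystal Wulff bound and the
texture Γ-liminf together with the exterior inputs `NoReconstructionGain`, `StackingLiminf` give
`SurfaceLiminf`, i.e. `LiminfAssembly`. -/
theorem liminfAssemblySplit_proof :
    Summit.Ventures.Crystal3D.Theses.StickyWulffConstant.LiminfAssemblySplit := by
  unfold LiminfAssemblySplit
  intro hG hF hP hT hNRG hSL ε hε
  by_contra H
  push Not at H
  choose Nf hNf x hx hlt using H
  have hκpos : (0 : ℝ) < 6 * (2 : ℝ) ^ ((1 : ℝ) / 3) := by positivity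
  have htend : Tendsto Nf atTop atTop := tendsto_atTop_mono hNf tendsto_id
  have hbd : ∀ k, 6 * (Nf k : ℝ) - (numContacts (x k) : ℝ) ≤
      6 * (2 : ℝ) ^ ((1 : ℝ) / 3) * (Nf k : ℝ) ^ ((2 : ℝ) / 3) := by
    intro k
    refine (hlt k).le.trans ?_
    exact mul_le_mul_of_nonneg_right (by linarith) (Real.rpow_nonneg (Nat.cast_nonneg _) _)
  set δ : ℝ := min (ε / (4 * (6 * (2 : ℝ) ^ ((1 : ℝ) / 3)))) (1 / 2) with hδdef
  have hδ : 0 < δ := lt_min (by positivity) (by norm_num)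
  have hδhalf : δ ≤ 1 / 2 := min_le_right _ _
  have hκδ : 6 * (2 : ℝ) ^ ((1 : ℝ) / 3) * δ ≤ ε / 4 := by
    calc 6 * (2 : ℝ) ^ ((1 : ℝ) / 3) * δ
        ≤ 6 * (2 : ℝ) ^ ((1 : ℝ) / 3) * (ε / (4 * (6 * (2 : ℝ) ^ ((1 : ℝ) / 3)))) :=
          mul_le_mul_of_nonneg_left (min_le_left _ _) hκpos.le
      _ = ε / 4 := by field_simp
  have hη : (0 : ℝ) < ε / 4 := by positivity
  obtain ⟨φ, hφ, p, n, G, A, c, m, hTex, hmass, hev⟩ :=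
    hT hG hF hNRG hSL (6 * (2 : ℝ) ^ ((1 : ℝ) / 3)) δ (ε / 4) hδ hη Nf x hx htend hbd
  have hlow := kappa_mul_one_sub_le_sum_energy (6 * (2 : ℝ) ^ ((1 : ℝ) / 3)) δ hκpos.le hδ.le
    hδhalf _ _ (fun i => hP (n i) (G i) (A i) (c i) (m i) (hTex i)) hmass
    (fun i => ENNReal.toReal_nonneg)
  obtain ⟨k, hk1, hk⟩ := ((eventually_ge_atTop 1).and hev).exists
  have hNk : (1 : ℝ) ≤ (Nf (φ k) : ℝ) := by
    have : 1 ≤ Nf (φ k) := hk1.trans ((hφ.id_le k).trans (hNf (φ k)))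
    exact_mod_cast this
  have ht : (0 : ℝ) < (Nf (φ k) : ℝ) ^ ((2 : ℝ) / 3) := Real.rpow_pos_of_pos (by linarith) _
  have hup : (6 * (Nf (φ k) : ℝ) - (numContacts (x (φ k)) : ℝ)) / (Nf (φ k) : ℝ) ^ ((2 : ℝ) / 3)
      < 6 * (2 : ℝ) ^ ((1 : ℝ) / 3) - ε := by
    rw [div_lt_iff₀ ht]; exact hlt (φ k)
  linarith

end Summit.Ventures.Crystal3D.Theorems
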